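import Summits.RiemannHypothesis.RiemannHypothesis.Theorems.MotivicDoorDecreeFinitePart
import HarnessLib

/-!
# The decreed distribution `N` at `u = 1`: the dilation law

Connes–Consani motivic door, cc-3 gen 18, second file (RH-free: no zeros of `ζ`, no positivity;
the explicit formula only through the exact cutoff identity `ccN_toMul_eq_cutoff`).
Framing: lottery ticket at the motivic door; RH probability negligible; consolation prizes are
real: a new semi-local Weil-positivity theorem, or a located gap in the Connes–Consani programme,
plus the ff-door theorem.  VERDICT (standing): `Nonempty ArithmeticWeilSurface` is a restatement
of RH in structure clothing, not a different-looking hypothesis.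

`MotivicDoorDecreeFinitePart` found the number sitting at `u = 1`: on the additive side
`N = Σ_n Λ(n) n^{-1/2} δ_{log n} + Pf(w dt) + ½(γ + log 2π) δ₀`, `w(t) = e^{t/2}/(2 sinh t)`.
This file pairs `N` with the DILATES `φ_ε(t) = φ(t/ε)` of a fixed real Weil test `φ` shrinking
onto the point `u = 1` and computes the answer exactly.

PROVED (`N = ccN` on `toMul`, `φ` a real Weil test, `w = weilArchDensity`):
* `ccN_toMul_dilate_eq` (exact, `ε ρ ≤ ½` where `φ = 0` off `(−ρ, ρ)`): `N(toMul φ_ε) =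
  (½(γ + log 2π) + ½ log ε + r(ε)) φ(0) + ε ∫₁^∞ w(εs) φ(s) ds − ε ∫₀¹ w(εs)(φ(0) − φ(s)) ds`,
  `r` the remainder of `finitePartCoeff_eq` (`|r(ε)| ≤ ¾ ε`);
* `abs_ccN_toMul_dilate_sub_le` (**the dilation law**, `ε w(εs) = 1/(2s) + O(ε)` uniformly):
  `|N(toMul φ_ε) − [(½(γ + log 2π) + ½ log ε) φ(0) + P(φ)]| ≤ B(φ) ε`,
  `P(φ) = ½ (∫₁^∞ φ(s) ds/s − ∫₀¹ (φ(0) − φ(s)) ds/s) = ½ Pf ∫₀^∞ φ(s) ds/s`,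
  `B(φ) = ¾|φ(0)| + ¼ ∫₁^∞ |φ| + ¼ ∫₀¹ |φ(0) − φ|`;
* `tendsto_ccN_toMul_dilate_sub_log`: `N(toMul φ_ε) − ½ φ(0) log ε → ½(γ + log 2π) φ(0) + P(φ)`
  as `ε → 0⁺`, for EVERY real Weil test `φ` (no support hypothesis);
* `tendsto_ccN_toMul_dilate_of_apply_zero` (**scale invariance on the hyperplane**): if
  `φ(0) = 0` then `N(toMul φ_ε) → ½ ∫₀^∞ φ(s) ds/s` — the tangent cone of `N` at `u = 1⁺` is
  the dilation-invariant measure `dt/(2t)`;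
* `tendsto_ccN_toMul_dilate_div_log` (`N(toMul φ_ε)/log ε → ½ φ(0)` for every `φ`),
  `tendsto_ccN_toMul_dilate_atBot` (`φ(0) > 0 ⇒ N(toMul φ_ε) → −∞`: **`N(1) = −∞` for every
  bump shape**, not only for the flat-top bumps of `exists_ccN_toMul_le_half_log`), and
  `tendsto_mul_ccN_toMul_dilate_div` (**the printed rate on the test-function side**): with
  `E = 1/ε`, `E · N(toMul φ(E·)) / (E log E) → −½ φ(0)` as `E → ∞`.
PRINTED (Connes, Essay, arXiv:1509.05576, p. 15 l. 37–47): "`N` is finite as a distribution, but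
when one looks at it as a function its value at `q = 1` is formally given by
`N(1) = 2 − lim_{ε→0} (ω(1+ε) − ω(1))/ε ∼ −½ E log E`, `E = 1/ε`, which is `−∞` and in fact
reflects, when `ε → 0`, the density of the zeros."  READING (ours): for a test `φ` with
`φ(0) = 1`, `ε⁻¹ N(toMul φ_ε)` is a smoothed version of the Essay's average of `N` over
`u ∈ [1, 1+ε]`; the last theorem gives for it exactly the printed leading term `−½ E log E` (it
depends on `φ` only through `φ(0)`), read here off the `|1 − u|⁻¹` archimedean term
(`w(t) = 1/(2t) + O(1)`, the terms the Essay blames on p. 15 l. 50–56) on the geometric side of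
the explicit formula — RH-free; the Essay reads the same rate off the zeros through `ω`.
NOT CLAIMED: anything about `ω`, the zeros, or positivity; nothing in this file bears on RH.
DATA: none (no numerics).
-/

noncomputable section

set_option linter.dupNamespace false

open Complex Set MeasureTheory Filter Topology Literature.NumberTheory.LFunctions
open Literature.NumberTheory.ConnesConsani2019
open Summit.RiemannHypothesis.RiemannHypothesis.Theorems.MotivicDoor.ArchLogLaplacian
open scoped Real ComplexConjugate ArithmeticFunction.vonMangoldt

namespace Summit.RiemannHypothesis.RiemannHypothesis.Theorems.MotivicDoor.ConnesConsani

variable {φ : ℝ → ℝ}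

/-! ## 1. Dilates of a Weil test; integrability bookkeeping -/

/-- Dilates of a real Weil test are real Weil tests.  PROVED. -/
theorem isWeilTest_dilate (hφ : IsWeilTest fun t ↦ (φ t : ℂ)) {ε : ℝ} (hε : ε ≠ 0) :
    IsWeilTest fun t ↦ (φ (t / ε) : ℂ) := by
  have e : (fun t ↦ (φ (t / ε) : ℂ)) = fun t ↦ (φ (ε⁻¹ * t) : ℂ) := by
    funext t
    rw [div_eq_inv_mul]
  rw [e]
  exact hφ.comp_mul (inv_ne_zero hε)

/-- `w κ` is integrable on `(δ, ∞)` for a real Weil test `κ` and `δ > 0`.  PROVED. -/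
theorem integrableOn_weilArchDensity_mul_Ioi {κ : ℝ → ℝ} (hκ : IsWeilTest fun t ↦ (κ t : ℂ))
    {δ : ℝ} (hδ : 0 < δ) : IntegrableOn (fun t ↦ weilArchDensity t * κ t) (Ioi δ) := by
  have h : IntegrableOn (fun t ↦ κ 0 * weilArchDensity t + weilArchDensity t * (κ t - κ 0))
      (Ioi δ) := ((integrableOn_weilArchDensity_Ioi hδ).const_mul (κ 0)).add
    ((integrableOn_weilArchDensity_mul_sub hκ).mono_set (Ioi_subset_Ioi hδ.le))
  exact IntegrableOn.congr_fun h (fun t _ ↦ by ring) measurableSet_Ioi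

/-- A real Weil test is continuous, compactly supported and integrable.  PROVED. -/
theorem integrable_of_isWeilTest (hφ : IsWeilTest fun t ↦ (φ t : ℂ)) : Integrable φ := by
  obtain ⟨R, -, hR⟩ := exists_eq_zero_of_lt_abs_of_isWeilTest hφ
  refine (AWS.contDiff_of_isWeilTest hφ).continuous.integrable_of_hasCompactSupport
    (HasCompactSupport.intro (isCompact_Icc (a := -(R + 1)) (b := R + 1)) fun t ht ↦ hR t ?_)
  rw [mem_Icc, not_and_or, not_le, not_le] at ht
  rcases ht with h | h
  · linarith [neg_le_abs t]
  · linarith [le_abs_self t]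

/-- `s ↦ φ(s)/(2s)` is integrable on `(1, ∞)`.  PROVED. -/
theorem integrableOn_div_two_mul_Ioi (hφ : IsWeilTest fun t ↦ (φ t : ℂ)) :
    IntegrableOn (fun s ↦ φ s / (2 * s)) (Ioi 1) := by
  have h := Integrable.bdd_mul (μ := volume.restrict (Ioi (1 : ℝ))) (c := 1 / 2)
    (integrable_of_isWeilTest hφ).integrableOn
    (by fun_prop : Measurable fun s : ℝ ↦ 1 / (2 * s)).aestronglyMeasurable
    (by
      filter_upwards [ae_restrict_mem measurableSet_Ioi] with s hs
      have hs1 := mem_Ioi.1 hs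
      rw [Real.norm_eq_abs, abs_of_pos (by positivity)]
      exact one_div_le_one_div_of_le two_pos (by linarith))
  exact IntegrableOn.congr_fun h (fun s _ ↦ by ring) measurableSet_Ioi

/-- `s ↦ (φ(0) − φ(s))/(2s)` is integrable on `(0, 1]` (it is bounded there).  PROVED. -/
theorem integrableOn_sub_div_two_mul_Ioc (hφ : IsWeilTest fun t ↦ (φ t : ℂ)) :
    IntegrableOn (fun s ↦ (φ 0 - φ s) / (2 * s)) (Ioc 0 1) := by
  obtain ⟨M₁, hM₁⟩ := exists_forall_abs_sub_apply_zero_le hφ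
  have hm : Measurable φ := (AWS.contDiff_of_isWeilTest hφ).continuous.measurable
  refine Measure.integrableOn_of_bounded (M := M₁ / 2)
    (by rw [Real.volume_Ioc]; exact ENNReal.ofReal_ne_top)
    ((measurable_const.sub hm).div (measurable_const.mul measurable_id)).aestronglyMeasurable ?_
  filter_upwards [ae_restrict_mem measurableSet_Ioc] with s hs
  rw [Real.norm_eq_abs, abs_div, abs_sub_comm, abs_of_pos (by linarith [hs.1] : (0 : ℝ) < 2 * s),
    div_le_iff₀ (by linarith [hs.1])]
  calc |φ s - φ 0| ≤ M₁ * s := hM₁ s hs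
    _ = M₁ / 2 * (2 * s) := by ring

/-! ## 2. The exact dilation identity -/

/-- **Exact dilation identity.**  For a real Weil test `φ` vanishing off `(−ρ, ρ)`, `ε > 0` with
`ε ρ ≤ ½` (no prime length in the support of `φ_ε = φ(·/ε)`):
`N(toMul φ_ε) = (½(γ + log 2π) + ½ log ε + r(ε)) φ(0) + ε ∫₁^∞ w(εs) φ(s) ds
  − ε ∫₀¹ w(εs) (φ(0) − φ(s)) ds`, with `r` the remainder of `finitePartCoeff_eq`.  PROVED. -/
theorem ccN_toMul_dilate_eq (hφ : IsWeilTest fun t ↦ (φ t : ℂ)) {ρ : ℝ}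
    (hρ : ∀ t, ρ ≤ |t| → φ t = 0) {ε : ℝ} (hε : 0 < ε) (hερ : ε * ρ ≤ 1 / 2) :
    ccN (toMul fun t ↦ φ (t / ε)) =
      ((Real.eulerMascheroniConstant + Real.log (2 * π)) / 2 + Real.log ε / 2 +
            ((∫ t in Ioc 0 ε, (Real.exp (t / 2) - 1) / (2 * Real.sinh t)) +
              1 / 2 * (Real.log (Real.sinh (ε / 2)) - Real.log (Real.cosh (ε / 2)) -
                Real.log (ε / 2)))) * φ 0 +
          ε * (∫ s in Ioi 1, weilArchDensity (ε * s) * φ s) -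
        ε * ∫ s in Ioc 0 1, weilArchDensity (ε * s) * (φ 0 - φ s) := by
  have hε0 := hε.ne'
  have hW := isWeilTest_dilate hφ hε0
  have hκa : ∀ t, 2 * (1 / 4 : ℝ) ≤ t → φ (t / ε) = 0 := fun t ht ↦ hρ _ (by
    rw [abs_div, abs_of_pos hε, le_div_iff₀ hε, abs_of_nonneg (by linarith)]
    linarith)
  have hS1 : ∑ n ∈ weilPrimeIndex (1 / 4 : ℝ), (Λ n : ℝ) / Real.sqrt n * φ (Real.log n / ε) =
      0 := Finset.sum_eq_zero fun n hn ↦ by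
    rw [vonMangoldt_eq_zero_of_mem_weilPrimeIndex le_rfl hn, zero_div, zero_mul]
  have hI : ∫ t in Ioi ε, weilArchDensity t * φ (t / ε) =
      ε * ∫ s in Ioi 1, weilArchDensity (ε * s) * φ s := by
    have h := integral_comp_mul_left_Ioi (fun s ↦ weilArchDensity (ε * s) * φ s) ε
      (inv_pos.2 hε)
    simp only [mul_inv_cancel_left₀ hε0, inv_inv, inv_mul_cancel₀ hε0, smul_eq_mul] at h
    rw [← h]
    exact setIntegral_congr_fun measurableSet_Ioi fun t _ ↦ by rw [div_eq_inv_mul]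
  have hJ : ∫ t in Ioc 0 ε, weilArchDensity t * (φ 0 - φ (t / ε)) =
      ε * ∫ s in Ioc 0 1, weilArchDensity (ε * s) * (φ 0 - φ s) := by
    have hεx : ∀ x : ℝ, ε * (x / ε) = x := fun x ↦ by field_simp
    have h := intervalIntegral.integral_comp_div (a := 0) (b := ε)
      (fun s ↦ weilArchDensity (ε * s) * (φ 0 - φ s)) hε0
    simp only [zero_div, div_self hε0, smul_eq_mul, hεx] at h
    rw [← intervalIntegral.integral_of_le hε.le, ← intervalIntegral.integral_of_le zero_le_one]
    exact h
  rw [ccN_toMul_eq_cutoff hW hκa hε, finitePartCoeff_eq (1 / 4) hε, hS1]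
  simp only [zero_div]
  rw [hI, hJ]
  ring

/-! ## 3. The dilation law with an explicit rate -/

/-- **The dilation law of `N` at `u = 1`.**  For a real Weil test `φ` vanishing off `(−ρ, ρ)`
and `0 < ε ≤ 1` with `ε ρ ≤ ½`:
`|N(toMul φ_ε) − [(½(γ + log 2π) + ½ log ε) φ(0) + ½∫₁^∞ φ ds/s − ½∫₀¹ (φ(0) − φ) ds/s]|
   ≤ (¾|φ(0)| + ¼∫₁^∞ |φ| + ¼∫₀¹ |φ(0) − φ|) ε`.  PROVED (`|ε w(εs) − 1/(2s)| ≤ ε/4`). -/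
theorem abs_ccN_toMul_dilate_sub_le (hφ : IsWeilTest fun t ↦ (φ t : ℂ)) {ρ : ℝ}
    (hρ : ∀ t, ρ ≤ |t| → φ t = 0) {ε : ℝ} (hε : 0 < ε) (hε1 : ε ≤ 1) (hερ : ε * ρ ≤ 1 / 2) :
    |ccN (toMul fun t ↦ φ (t / ε)) -
        (((Real.eulerMascheroniConstant + Real.log (2 * π)) / 2 + Real.log ε / 2) * φ 0 +
          ((∫ s in Ioi 1, φ s / (2 * s)) - ∫ s in Ioc 0 1, (φ 0 - φ s) / (2 * s)))| ≤
      (3 / 4 * |φ 0| + 1 / 4 * (∫ s in Ioi 1, |φ s|) + 1 / 4 * ∫ s in Ioc 0 1, |φ 0 - φ s|) *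
        ε := by
  have hε0 := hε.ne'
  have hW := isWeilTest_dilate hφ hε0
  have hφi := integrable_of_isWeilTest hφ
  have hφc : Continuous φ := (AWS.contDiff_of_isWeilTest hφ).continuous
  -- the kernel estimate `|ε w(εs) − 1/(2s)| ≤ ε/4` on `s > 0`
  have hK : ∀ s : ℝ, 0 < s → |ε * weilArchDensity (ε * s) - 1 / (2 * s)| ≤ ε / 4 := by
    intro s hs
    have h := abs_weilArchDensity_sub_inv_le (mul_pos hε hs)
    have e : ε * weilArchDensity (ε * s) - 1 / (2 * s) =
        ε * (weilArchDensity (ε * s) - 1 / (2 * (ε * s))) := by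
      field_simp
    rw [e, abs_mul, abs_of_pos hε]
    calc ε * |weilArchDensity (ε * s) - 1 / (2 * (ε * s))| ≤ ε * (1 / 4) :=
        mul_le_mul_of_nonneg_left h hε.le
      _ = ε / 4 := by ring
  -- the piece on `(1, ∞)`
  have hA1 : IntegrableOn (fun s ↦ weilArchDensity (ε * s) * φ s) (Ioi 1) := by
    have h := (integrableOn_Ioi_comp_mul_left_iff (fun t ↦ weilArchDensity t * φ (t / ε)) 1
      hε).2 (by rw [mul_one]; exact integrableOn_weilArchDensity_mul_Ioi hW hε)
    exact h.congr_fun (fun s _ ↦ by simp only [mul_div_cancel_left₀ s hε0]) measurableSet_Ioi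
  have hP1 := integrableOn_div_two_mul_Ioi hφ
  have hA : |ε * (∫ s in Ioi 1, weilArchDensity (ε * s) * φ s) - ∫ s in Ioi 1, φ s / (2 * s)| ≤
      ε / 4 * ∫ s in Ioi 1, |φ s| := by
    rw [← integral_const_mul, ← integral_sub (hA1.const_mul ε) hP1, ← integral_const_mul]
    refine (Real.norm_eq_abs _).symm.trans_le (norm_integral_le_of_norm_le
      ((hφi.integrableOn (s := Ioi 1)).abs.const_mul (ε / 4)) ?_)
    filter_upwards [ae_restrict_mem measurableSet_Ioi] with s hs
    have e : ε * (weilArchDensity (ε * s) * φ s) - φ s / (2 * s) =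
        (ε * weilArchDensity (ε * s) - 1 / (2 * s)) * φ s := by ring
    rw [e, Real.norm_eq_abs, abs_mul]
    exact mul_le_mul_of_nonneg_right (hK s (zero_lt_one.trans hs)) (abs_nonneg _)
  -- the piece on `(0, 1]`
  have hB1 : IntegrableOn (fun s ↦ weilArchDensity (ε * s) * (φ 0 - φ s)) (Ioc 0 1) := by
    have h : IntegrableOn (fun s ↦ -(weilArchDensity (ε * s) * (φ (ε * s / ε) - φ (0 / ε))))
        (Ioc 0 1) := (((integrableOn_Ioi_comp_mul_left_iff
      (fun t ↦ weilArchDensity t * (φ (t / ε) - φ (0 / ε))) 0 hε).2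
      (by rw [mul_zero]; exact integrableOn_weilArchDensity_mul_sub hW)).mono_set
      Ioc_subset_Ioi_self).neg
    refine IntegrableOn.congr_fun h (fun s _ ↦ ?_) measurableSet_Ioc
    rw [mul_div_cancel_left₀ s hε0, zero_div]
    ring
  have hP2 := integrableOn_sub_div_two_mul_Ioc hφ
  have hB : |ε * (∫ s in Ioc 0 1, weilArchDensity (ε * s) * (φ 0 - φ s)) -
      ∫ s in Ioc 0 1, (φ 0 - φ s) / (2 * s)| ≤ ε / 4 * ∫ s in Ioc 0 1, |φ 0 - φ s| := by
    have hi : IntegrableOn (fun s ↦ |φ 0 - φ s|) (Ioc (0 : ℝ) 1) :=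
      ((continuous_const.sub hφc).continuousOn.integrableOn_Icc.mono_set
        Ioc_subset_Icc_self).abs
    rw [← integral_const_mul, ← integral_sub (hB1.const_mul ε) hP2, ← integral_const_mul]
    refine (Real.norm_eq_abs _).symm.trans_le (norm_integral_le_of_norm_le (hi.const_mul _) ?_)
    filter_upwards [ae_restrict_mem measurableSet_Ioc] with s hs
    have e : ε * (weilArchDensity (ε * s) * (φ 0 - φ s)) - (φ 0 - φ s) / (2 * s) =
        (ε * weilArchDensity (ε * s) - 1 / (2 * s)) * (φ 0 - φ s) := by ring
    rw [e, Real.norm_eq_abs, abs_mul]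
    exact mul_le_mul_of_nonneg_right (hK s hs.1) (abs_nonneg _)
  have hr := abs_finitePartRem_le hε (by linarith)
  rw [ccN_toMul_dilate_eq hφ hρ hε hερ]
  have e : ((Real.eulerMascheroniConstant + Real.log (2 * π)) / 2 + Real.log ε / 2 +
            ((∫ t in Ioc 0 ε, (Real.exp (t / 2) - 1) / (2 * Real.sinh t)) +
              1 / 2 * (Real.log (Real.sinh (ε / 2)) - Real.log (Real.cosh (ε / 2)) -
                Real.log (ε / 2)))) * φ 0 +
          ε * (∫ s in Ioi 1, weilArchDensity (ε * s) * φ s) -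
        ε * (∫ s in Ioc 0 1, weilArchDensity (ε * s) * (φ 0 - φ s)) -
        (((Real.eulerMascheroniConstant + Real.log (2 * π)) / 2 + Real.log ε / 2) * φ 0 +
          ((∫ s in Ioi 1, φ s / (2 * s)) - ∫ s in Ioc 0 1, (φ 0 - φ s) / (2 * s))) =
      ((∫ t in Ioc 0 ε, (Real.exp (t / 2) - 1) / (2 * Real.sinh t)) +
            1 / 2 * (Real.log (Real.sinh (ε / 2)) - Real.log (Real.cosh (ε / 2)) -
              Real.log (ε / 2))) * φ 0 +
          (ε * (∫ s in Ioi 1, weilArchDensity (ε * s) * φ s) - ∫ s in Ioi 1, φ s / (2 * s)) -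
        (ε * (∫ s in Ioc 0 1, weilArchDensity (ε * s) * (φ 0 - φ s)) -
          ∫ s in Ioc 0 1, (φ 0 - φ s) / (2 * s)) := by ring
  have tri : ∀ x y z : ℝ, |x + y - z| ≤ |x| + |y| + |z| := fun x y z ↦
    (abs_sub _ _).trans (add_le_add (abs_add_le _ _) le_rfl)
  rw [e]
  refine (tri _ _ _).trans ?_
  rw [abs_mul]
  calc _ ≤ 3 / 4 * ε * |φ 0| + ε / 4 * (∫ s in Ioi 1, |φ s|) +
        ε / 4 * ∫ s in Ioc 0 1, |φ 0 - φ s| :=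
      add_le_add (add_le_add (mul_le_mul_of_nonneg_right hr (abs_nonneg _)) hA) hB
    _ = _ := by ring

/-! ## 4. The limits as `ε → 0⁺` -/

/-- **Dilation law, limit form**: for EVERY real Weil test `φ`, as `ε → 0⁺`,
`N(toMul φ(·/ε)) − ½ φ(0) log ε → ½(γ + log 2π) φ(0) + ½∫₁^∞ φ ds/s − ½∫₀¹ (φ(0) − φ) ds/s`.
PROVED. -/
theorem tendsto_ccN_toMul_dilate_sub_log (hφ : IsWeilTest fun t ↦ (φ t : ℂ)) :
    Tendsto (fun ε ↦ ccN (toMul fun t ↦ φ (t / ε)) - Real.log ε / 2 * φ 0) (𝓝[>] 0)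
      (𝓝 ((Real.eulerMascheroniConstant + Real.log (2 * π)) / 2 * φ 0 +
        ((∫ s in Ioi 1, φ s / (2 * s)) - ∫ s in Ioc 0 1, (φ 0 - φ s) / (2 * s)))) := by
  obtain ⟨R, hR0, hR⟩ := exists_eq_zero_of_lt_abs_of_isWeilTest hφ
  have hρ : ∀ t, R + 1 ≤ |t| → φ t = 0 := fun t ht ↦ hR t (by linarith)
  have hb : Tendsto (fun ε : ℝ ↦ (3 / 4 * |φ 0| + 1 / 4 * (∫ s in Ioi 1, |φ s|) +
      1 / 4 * ∫ s in Ioc 0 1, |φ 0 - φ s|) * ε) (𝓝[>] 0) (𝓝 0) := by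
    refine tendsto_nhdsWithin_of_tendsto_nhds ?_
    simpa only [mul_zero, id_eq] using (tendsto_id : Tendsto (id : ℝ → ℝ) (𝓝 0) (𝓝 0)).const_mul
      (3 / 4 * |φ 0| + 1 / 4 * (∫ s in Ioi 1, |φ s|) + 1 / 4 * ∫ s in Ioc 0 1, |φ 0 - φ s|)
  rw [← tendsto_sub_nhds_zero_iff]
  refine squeeze_zero_norm' ?_ hb
  have hm : (0 : ℝ) < min 1 (1 / (2 * (R + 1))) := lt_min one_pos (by positivity)
  filter_upwards [Ioc_mem_nhdsGT hm] with ε hε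
  have hε1 : ε ≤ 1 := hε.2.trans (min_le_left _ _)
  have hερ : ε * (R + 1) ≤ 1 / 2 := by
    have h := hε.2.trans (min_le_right _ _)
    rw [le_div_iff₀ (by positivity)] at h
    linarith
  have h := abs_ccN_toMul_dilate_sub_le hφ hρ hε.1 hε1 hερ
  rw [Real.norm_eq_abs]
  convert h using 2
  ring

/-- **Scale invariance on the hyperplane `φ(0) = 0`.**  If `φ(0) = 0` then
`N(toMul φ(·/ε)) → ½ ∫₀^∞ φ(s) ds/s` as `ε → 0⁺`: on tests vanishing at the point, the dilates
see only the dilation-invariant tangent measure `dt/(2t)` of `N` at `u = 1⁺`.  PROVED. -/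
theorem tendsto_ccN_toMul_dilate_of_apply_zero (hφ : IsWeilTest fun t ↦ (φ t : ℂ))
    (h0 : φ 0 = 0) :
    Tendsto (fun ε ↦ ccN (toMul fun t ↦ φ (t / ε))) (𝓝[>] 0)
      (𝓝 (∫ s in Ioi 0, φ s / (2 * s))) := by
  have h := tendsto_ccN_toMul_dilate_sub_log hφ
  have hP2 : IntegrableOn (fun s ↦ φ s / (2 * s)) (Ioc 0 1) := by
    have h2 := (integrableOn_sub_div_two_mul_Ioc hφ).neg
    refine h2.congr_fun (fun s _ ↦ ?_) measurableSet_Ioc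
    simp only [Pi.neg_apply, h0, zero_sub, neg_div, neg_neg]
  have hsplit : ∫ s in Ioi 0, φ s / (2 * s) =
      (∫ s in Ioc 0 1, φ s / (2 * s)) + ∫ s in Ioi 1, φ s / (2 * s) := by
    rw [← Ioc_union_Ioi_eq_Ioi zero_le_one, setIntegral_union (Set.Ioc_disjoint_Ioi le_rfl)
      measurableSet_Ioi hP2 (integrableOn_div_two_mul_Ioi hφ)]
  have hneg : ∫ s in Ioc 0 1, (0 - φ s) / (2 * s) = -∫ s in Ioc 0 1, φ s / (2 * s) := by
    rw [← integral_neg]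
    exact setIntegral_congr_fun measurableSet_Ioc fun s _ ↦ by rw [zero_sub, neg_div]
  simp only [h0, mul_zero, sub_zero, zero_add, hneg, sub_neg_eq_add] at h
  rwa [hsplit, add_comm]

/-- **`N(toMul φ(·/ε)) / log ε → ½ φ(0)`** as `ε → 0⁺`, for every real Weil test `φ`.
PROVED. -/
theorem tendsto_ccN_toMul_dilate_div_log (hφ : IsWeilTest fun t ↦ (φ t : ℂ)) :
    Tendsto (fun ε ↦ ccN (toMul fun t ↦ φ (t / ε)) / Real.log ε) (𝓝[>] 0)
      (𝓝 (φ 0 / 2)) := by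
  have h1 := tendsto_ccN_toMul_dilate_sub_log hφ
  have h2 : Tendsto (fun ε ↦ (Real.log ε)⁻¹) (𝓝[>] 0) (𝓝 0) :=
    tendsto_inv_atBot_zero.comp Real.tendsto_log_nhdsGT_zero
  have h3 := (h1.mul h2).add_const (φ 0 / 2)
  rw [mul_zero, zero_add] at h3
  refine h3.congr' ?_
  filter_upwards [Ioo_mem_nhdsGT one_pos] with ε hε
  have hl : Real.log ε ≠ 0 := (Real.log_neg hε.1 hε.2).ne
  field_simp
  ring

/-- **`N(1) = −∞` for every bump shape.**  If `φ(0) > 0` then `N(toMul φ(·/ε)) → −∞` as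
`ε → 0⁺`.  PROVED. -/
theorem tendsto_ccN_toMul_dilate_atBot (hφ : IsWeilTest fun t ↦ (φ t : ℂ)) (h0 : 0 < φ 0) :
    Tendsto (fun ε ↦ ccN (toMul fun t ↦ φ (t / ε))) (𝓝[>] 0) atBot := by
  have h1 := tendsto_ccN_toMul_dilate_sub_log hφ
  have h2 : Tendsto (fun ε ↦ Real.log ε * (φ 0 / 2)) (𝓝[>] 0) atBot :=
    Real.tendsto_log_nhdsGT_zero.atBot_mul_const (half_pos h0)
  exact (h2.atBot_add h1).congr fun ε ↦ by ring

/-- **The printed rate on the test-function side** (`E = 1/ε`): for every real Weil test `φ`,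
`E · N(toMul φ(E·)) / (E log E) → −½ φ(0)` as `E → ∞` — with `φ(0) = 1` this is the Essay's
"`N(1) ∼ −½ E log E`" (p. 15 l. 41–47), read here off the `|1 − u|⁻¹` term, RH-free.  PROVED. -/
theorem tendsto_mul_ccN_toMul_dilate_div (hφ : IsWeilTest fun t ↦ (φ t : ℂ)) :
    Tendsto (fun E ↦ E * ccN (toMul fun t ↦ φ (E * t)) / (E * Real.log E)) atTop
      (𝓝 (-(φ 0 / 2))) := by
  have h := ((tendsto_ccN_toMul_dilate_div_log hφ).comp tendsto_inv_atTop_nhdsGT_zero).neg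
  refine h.congr' ?_
  filter_upwards [eventually_gt_atTop 1] with E hE
  have hE0 : E ≠ 0 := by positivity
  have hl : Real.log E ≠ 0 := (Real.log_pos hE).ne'
  have e : (fun t ↦ φ (t / E⁻¹)) = fun t ↦ φ (E * t) := by
    funext t
    rw [div_inv_eq_mul, mul_comm]
  simp only [Function.comp_def, e, Real.log_inv]
  field_simp

end Summit.RiemannHypothesis.RiemannHypothesis.Theorems.MotivicDoor.ConnesConsani

end
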